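import Literature.NumberTheory.EllipticCurves.BSDQuadraticDescentArchimedeanProofs
import Literature.NumberTheory.EllipticCurves.QuadraticTwistPadicReduction
import Literature.NumberTheory.EllipticCurves.BSDInvariantsProofs
import Literature.NumberTheory.EllipticCurves.ComplexPeriodProofs
import Mathlib.NumberTheory.NumberField.InfinitePlace.TotallyRealComplex
import HarnessLib

/-!
# The archimedean comparison over a REAL quadratic field: `Ω(W)·Ω(W^{(d_K)}) = Ω(W_K/K)`
# (row T-MIL-REAL, FILE F-1; seat n1011-p01 GEN 7)

HONEST FRAMING (cell `b2b-bsdres`, run/shared/lean/b2b/bsd-rank1-residual/, verbatim in every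
file): the goal of the cell is to DELETE the COMBINATION-SHAPED residual classes of the
Birch–Swinnerton-Dyer formula for ALL analytic-rank `≤ 1` elliptic curves over `ℚ` — "full BSD
formula for every rank `≤ 1` curve in class `C`" assembled STRICTLY from published theorems — so
that the rank-`≤ 1` remainder becomes exactly the CONSTRUCTION-SHAPED classes, which are TYPED
(missing-input `Prop`s), NOT attempted. This is not "finishing BSD". Sub-classes X3♯(M) / X4(M)
(additive, potentially multiplicative prime; base-change-and-descend): a RESEARCH ROUTE; they stay
CONSTRUCTION-SHAPED; nothing is booked by this file; no mark / label moved. THEOREMS ONLY: no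
definition, no named fact, no `sorry`.

## What (row T-MIL-REAL = D-3 of T-MIL-SHA, `cells/n1011/skel/T-MIL-REAL.md` §1 (F-1))

The tree has the archimedean part of Milne's quadratic base-change comparison for an IMAGINARY
quadratic field `K` (`realPeriod_mul_realPeriod_quadraticTwist_eq_mul_bsdPeriod`:
`Ω(W)·Ω(W^{(d_K)}) = n_W · Ω(W_K/K)`, one complex place, `Ω(W_K/K) = 2 covol/√|d_K|`). FILE E-2 of
row T-MIL-R1 takes the archimedean identity as a HYPOTHESIS with a factor `n`. This file proves
the REAL quadratic case, where the factor is `n = 1`: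

* `realPeriod_quadraticTwist_one` — `Ω(V^{(1)}) = Ω(V)` over `ℝ` (the completed square
  `V^{(1)} = (1, 0, −a₁/2, −a₃/2) • V`, `realPeriod_smul_holds` with `|u| = 1`);
* `realPeriod_quadraticTwist_of_pos` — **`Ω(V^{(D)}) = Ω(V)/√D` for `D > 0`** over `ℝ`
  (`V^{(D)} = ((√D)⁻¹, 0, 0, 0) • V^{(1)}`: the twist by a positive real is a change of variables,
  and the real period is a length, scaling by `|u|`; Silverman *AEC* X.2 Prop. 2.4 / the model of
  `WeierstrassCurve.quadraticTwist`);
* `bsdPeriod_baseChange_eq_sq_div_sqrt_of_isTotallyReal` — for `K` real quadratic,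
  **`Ω(W_K/K) = Ω(W)²/√d_K`**: both infinite places are real and carry the period `Ω(W)` of
  `W ⊗ ℝ` (`placePeriod_of_isReal`, unique `ℚ →+* ℝ`), `#(places) = 2`, `|d_K| = d_K > 0`
  (`NumberField.sign_discr`, `r₂ = 0`) — the normalisation of Dokchitser–Dokchitser 2010 Conj. 2.1
  / Burungale–Flach 2024 Remark 2 (`∏_{v real} ∫|ω| / √|d_K|`, tree `ComplexPeriod.bsdPeriod`);
* `realPeriodRat_mul_realPeriodRat_quadraticTwist_eq_bsdPeriod_of_isTotallyReal` — hence
  **`Ω(W)·Ω(W^{(d_K)}) = 1 · Ω(W_K/K)`** in the `realPeriodRat` currency of FILE E-2's `hA`.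

HONEST LIMITS: the archimedean identity only (no BSD statement here); `K` real QUADRATIC; TOOL
theorems; closes no class; moves no mark; no named fact.

References: J. S. Milne, Invent. Math. 17 (1972) §1 [Milne1972ArithmeticAV]; T. Dokchitser,
V. Dokchitser, Ann. of Math. 172 (2010) Conj. 2.1 [DokchitserDokchitserAnnals2010]; A. Burungale,
M. Flach, Camb. J. Math. 12 (2024) Remark 2 [BurungaleFlach2024]; J. H. Silverman, *AEC* 2nd ed.,
X.2 Prop. 2.4, III.1 Table 3.1 [SilvermanAEC2009].
-/

noncomputable section

open scoped Classical NumberField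

open WeierstrassCurve NumberField NumberField.InfinitePlace

namespace Summit.BirchSwinnertonDyer.Rank1Residual.AdditivePotMult

/-! ## §1 Over `ℝ`: the real period of a twist by a positive real -/

section Real

variable (V : WeierstrassCurve ℝ)

/-- **`Ω(V^{(1)}) = Ω(V)`**: the completed-square model `V^{(1)}` is `C₀ • V` with
`C₀ = (1, 0, −a₁/2, −a₃/2)` (the tree's `exists_variableChange_quadraticTwist_one`, made explicit),
and the real period scales by `|u| = 1` (`realPeriod_smul_holds`). [cite: SilvermanAEC2009, III.1 Table 3.1] -/
theorem realPeriod_quadraticTwist_one : (V.quadraticTwist 1).realPeriod = V.realPeriod := by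
  have hC : (⟨1, 0, -V.a₁ / 2, -V.a₃ / 2⟩ : VariableChange ℝ) • V = V.quadraticTwist 1 := by
    ext
    · simp only [variableChange_a₁, quadraticTwist_a₁, inv_one, Units.val_one]
      ring
    · simp only [variableChange_a₂, quadraticTwist_a₂, b₂, inv_one, Units.val_one]
      ring
    · simp only [variableChange_a₃, quadraticTwist_a₃, inv_one, Units.val_one]
      ring
    · simp only [variableChange_a₄, quadraticTwist_a₄, b₄, inv_one, Units.val_one]
      ring
    · simp only [variableChange_a₆, quadraticTwist_a₆, b₆, inv_one, Units.val_one]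
      ring
  rw [← hC, V.realPeriod_smul_holds, Units.val_one, abs_one, one_mul]

/-- **`Ω(V^{(D)}) = Ω(V)/√D` for `D > 0`** over `ℝ`: `V^{(D)} = V^{(1·(√D)²)} = C₁ • V^{(1)}` with
`C₁ = ((√D)⁻¹, 0, 0, 0)` (the tree's `exists_variableChange_quadraticTwist_mul_sq`, explicit), the
real period scales by `|u| = (√D)⁻¹` (`realPeriod_smul_holds`), and `Ω(V^{(1)}) = Ω(V)`. (For
`D < 0` the scaling is by an imaginary number and the comparison is the tree's
`realPeriod_mul_realPeriod_quadraticTwist_mul_sqrt` with the component factor `n_W`.)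
[cite: SilvermanAEC2009, X.2 Prop. 2.4 and III.1 Table 3.1] -/
theorem realPeriod_quadraticTwist_of_pos {D : ℝ} (hD : 0 < D) :
    (V.quadraticTwist D).realPeriod = V.realPeriod / Real.sqrt D := by
  set e : ℝ := Real.sqrt D with he_def
  have he : e ≠ 0 := (Real.sqrt_pos.mpr hD).ne'
  have he2 : D = 1 * e ^ 2 := by rw [one_mul, he_def, Real.sq_sqrt hD.le]
  have hC : (⟨(Units.mk0 e he)⁻¹, 0, 0, 0⟩ : VariableChange ℝ) • V.quadraticTwist 1 =
      V.quadraticTwist (1 * e ^ 2) := by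
    ext
    · simp [variableChange_a₁]
    · simp only [variableChange_a₂, quadraticTwist_a₂, quadraticTwist_a₁, inv_inv, Units.val_mk0]
      ring
    · simp [variableChange_a₃]
    · simp only [variableChange_a₄, quadraticTwist_a₁, quadraticTwist_a₂, quadraticTwist_a₃,
        quadraticTwist_a₄, inv_inv, Units.val_mk0]
      ring
    · simp only [variableChange_a₆, quadraticTwist_a₁, quadraticTwist_a₂, quadraticTwist_a₃,
        quadraticTwist_a₄, quadraticTwist_a₆, inv_inv, Units.val_mk0]
      ring
  rw [he2, ← hC, (V.quadraticTwist 1).realPeriod_smul_holds, realPeriod_quadraticTwist_one,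
    Units.val_inv_eq_inv_val, Units.val_mk0, abs_inv, abs_of_pos (Real.sqrt_pos.mpr hD),
    div_eq_inv_mul]

end Real

/-! ## §2 Over a real quadratic field: `Ω(W_K/K) = Ω(W)²/√d_K` -/

section RealQuadratic

variable (W : WeierstrassCurve ℚ) (K : Type*) [Field K] [NumberField K] [IsTotallyReal K]

/-- A totally real field has positive discriminant, as a real number (`sign d_K = (−1)^{r₂}`,
Mathlib `NumberField.sign_discr`, `r₂ = 0`; the integer statement for the specific field `ℚ(√73)`
is the tree's `Sqrt73.discr_pos`). [folklore] -/
theorem realCast_discr_pos_of_isTotallyReal : (0 : ℝ) < (NumberField.discr K : ℝ) := by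
  have h := NumberField.sign_discr K
  rw [IsTotallyReal.nrComplexPlaces_eq_zero, pow_zero] at h
  exact_mod_cast Int.sign_eq_one_iff_pos.mp h

/-- A totally real quadratic field has exactly two infinite places (`r₁ + 2r₂ = [K:ℚ]`, `r₂ = 0`).
[folklore] -/
theorem card_infinitePlace_eq_two_of_isTotallyReal (h2 : Module.finrank ℚ K = 2) :
    Fintype.card (InfinitePlace K) = 2 := by
  rw [card_eq_nrRealPlaces_add_nrComplexPlaces, IsTotallyReal.nrComplexPlaces_eq_zero, add_zero,
    ← IsTotallyReal.finrank, h2]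

/-- At every (real) place of a totally real `K`, the local period of `W_K` is the real period of
`W ⊗ ℝ` (the real embedding restricted to `ℚ` is the unique `ℚ →+* ℝ`). [folklore] -/
theorem placePeriod_baseChange_of_isTotallyReal (w : InfinitePlace K) :
    (W.baseChange K).placePeriod w = (W.baseChange ℝ).realPeriod := by
  have hw : w.IsReal := IsTotallyReal.isReal w
  rw [(W.baseChange K).placePeriod_of_isReal hw, WeierstrassCurve.baseChange,
    WeierstrassCurve.baseChange, map_map]
  congr 2
  exact Subsingleton.elim _ _

/-- **`Ω(W_K/K) = Ω(W)²/√d_K` for `K` real quadratic**: `bsdPeriod = (∏_w placePeriod w)/√|d_K|`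
with two real places each carrying `Ω(W ⊗ ℝ)`, and `|d_K| = d_K`. The normalisation
`∏_{v real} ∫_{E(K_v)}|ω| / |d_K|^{1/2}` of Dokchitser–Dokchitser 2010 Conj. 2.1 / Burungale–Flach
2024 Remark 2. [cite: DokchitserDokchitserAnnals2010, Conj. 2.1] [cite: BurungaleFlach2024, Remark 2 (arXiv p. 4)] -/
theorem bsdPeriod_baseChange_eq_sq_div_sqrt_of_isTotallyReal (h2 : Module.finrank ℚ K = 2) :
    (W.baseChange K).bsdPeriod =
      (W.baseChange ℝ).realPeriod ^ 2 / Real.sqrt ((NumberField.discr K : ℚ) : ℝ) := by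
  rw [bsdPeriod_def, Finset.prod_congr rfl fun w _ => placePeriod_baseChange_of_isTotallyReal W K w,
    Finset.prod_const, Finset.card_univ, card_infinitePlace_eq_two_of_isTotallyReal K h2]
  congr 2
  rw [abs_of_pos (realCast_discr_pos_of_isTotallyReal K)]
  push_cast
  rfl

/-- **Archimedean comparison, REAL quadratic `K`: `Ω(W)·Ω(W^{(d_K)}) = 1 · Ω(W_K/K)`** in the
`realPeriodRat` currency of FILE E-2's hypothesis `hA` (`n = 1`): `Ω(W^{(d_K)}) = Ω(W)/√d_K`
(`realPeriod_quadraticTwist_of_pos`, `d_K > 0`, `(W^{(d)}) ⊗ ℝ = (W ⊗ ℝ)^{(d)}`) and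
`Ω(W_K/K) = Ω(W)²/√d_K` (`bsdPeriod_baseChange_eq_sq_div_sqrt_of_isTotallyReal`). The real
twin of the tree's imaginary `realPeriod_mul_realPeriod_quadraticTwist_eq_mul_bsdPeriod` (there
the factor is `n_W ∈ {1,2}`; here it is `1`). [cite: Milne1972ArithmeticAV, §1 Thm. 1]
[cite: DokchitserDokchitserAnnals2010, Conj. 2.1] -/
theorem realPeriodRat_mul_realPeriodRat_quadraticTwist_eq_bsdPeriod_of_isTotallyReal
    (h2 : Module.finrank ℚ K = 2) :
    W.realPeriodRat * (W.quadraticTwist (NumberField.discr K : ℚ)).realPeriodRat =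
      ((1 : ℕ) : ℝ) * (W.baseChange K).bsdPeriod := by
  have hd : (0 : ℝ) < ((NumberField.discr K : ℚ) : ℝ) := by
    exact_mod_cast realCast_discr_pos_of_isTotallyReal K
  have htw : (W.quadraticTwist (NumberField.discr K : ℚ)).baseChange ℝ =
      (W.baseChange ℝ).quadraticTwist ((NumberField.discr K : ℚ) : ℝ) := by
    rw [WeierstrassCurve.baseChange, map_quadraticTwist, eq_ratCast]
    rfl
  rw [realPeriodRat, realPeriodRat, htw, realPeriod_quadraticTwist_of_pos _ hd,
    bsdPeriod_baseChange_eq_sq_div_sqrt_of_isTotallyReal W K h2, Nat.cast_one, one_mul, sq,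
    mul_div_assoc]

end RealQuadratic

end Summit.BirchSwinnertonDyer.Rank1Residual.AdditivePotMult

end
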